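import Literature.NumberTheory.Automorphic.LanglandsShelstad1987.Defs
import Mathlib.Algebra.Ring.Action.Subobjects
import Mathlib.FieldTheory.IsAlgClosed.Basic
import HarnessLib

/-!
# Langlands–Shelstad (1987) §2 «Key Lemmas», first half: (2.1) General remarks — Lemmas 2.1.A–2.1.D;
# (2.2) a-data — Lemmas 2.2.A–2.2.C; (2.3) An application — Lemmas 2.3.A–2.3.B (IAS reissue pp. 10–18),
# every numbered lemma as a NAMED FACT `def … : Prop` (statements only; carpet squad TN, row TN-t01)

Topic `Literature/NumberTheory/Automorphic/LanglandsShelstad1987/`; namespace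
`Literature.NumberTheory.Automorphic.LanglandsShelstad1987.KeyLemmasI`.  All carriers come from the sibling ★
`…LanglandsShelstad1987.Defs` (conventions (C1)–(C6) there: «`k^× ⊗ X`» = `UnitsTensor X k = X ⊗[ℤ] Additive kˣ`
written additively with `Σ` acting through `X` by Mathlib's `TensorProduct.leftDistribMulAction`; gauges
`p : X → ℤˣ`; `tCochain` = `t_p`, `uCochain` = `u_p`, `vCochain` = `v_p`, `actDiag` = the diagonal (Galois ⊗ `X`)
action, `cobdDiag` = its inhomogeneous coboundary).  No proofs, no `sorry`, no `axiom`, no `instance`, no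
`notation`: each lemma is `def Lemma_… : Prop := <the printed statement>`; a discharge later is
`theorem Lemma_…_holds : Lemma_…`.

WHAT IS CONCRETE AND WHAT IS NOT.  Print's setting of (2.1) from «Let `X` be a free finitely generated
`ℤ`-module …» on (p. 11) is pure algebra and is typed VERBATIM over Mathlib: Lemmas 2.1.B, 2.1.C, 2.1.D, 2.2.A,
2.2.B, 2.2.C and 2.3.B are closed statements about the explicit cochains.  Two items involve a connected reductive
group `G` over `k̄`, for which Mathlib (pin v4.32.0) has no notion:
* **Lemma 2.1.A** computes the 2-cocycle `t(θ₁, θ₂)` of the TITS SECTION `θ ↦ n(θ)` of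
  `Norm(T(k̄), G(k̄)) ⋊ Γ → Ω ⋊ Γ` (`n(α) = exp X_α exp(−X_{−α}) exp X_α`, p. 11).  The section itself cannot be
  constructed here; the lemma is typed as a predicate `Lemma_2_1_A … ι n` ON an explicitly given extension
  `ι : T(k̄) → E`, `n : Σ → E` (the consumer supplies the Tits section of its group), saying
  «`n(θ₁)n(θ₂) = t_p(θ₁,θ₂) n(θ₁θ₂)` with `p` the `B`-positivity gauge» — print's display combined with 2.1.A.
* **Lemma 2.3.A** («The cocycle `b` is trivial», p. 15) concerns `b(σ_T) = u m(σ′_T) σ(u)⁻¹ m(σ_T)⁻¹` built from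
  `m(σ_T) = x(σ_T) n(ω_T(σ))` in `G(k̄)`.  Print reduces it (p. 16: «`b(σ_T)` is equivalent to
  `μ(x(σ′_T))x(σ_T)⁻¹ t_p(μ,μ⁻¹) μ[t_p(μ⁻¹ω_T(σ), σ(μ)) t_p(μ⁻¹, ω_T(σ))]`» — equality up to the coboundary
  `λ⁻¹σ_T(λ)`) to a statement about an EXPLICIT 1-cochain of `Γ_T` in `T(k̄) = k̄^× ⊗ X_*(T)`; we type that
  cochain form as `Lemma_2_3_A`, which is equivalent to print's lemma given the displayed reduction, and say so.
Everything else on pp. 14–18 ((2.3.1)–(2.3.5): how `λ(T) ∈ H¹(T)` changes with the splitting, the a-data, `B`,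
conjugation, localisation) is unnumbered running text defining `λ(T)`; it needs `G` and is NOT typed here (it is
the input of the term `Δ_I` in TN-t02's `TransferFactorDefinition.lean`).

READING NOTE for Lemma 2.3.B (a) (p. 16).  The reissue prints `δ = ∏^p_{1,μ} a_α^{−α^∨}` (product over `α` with
`p(α) = 1`, `p(μ⁻¹α) = −1`); the typist re-derived (a) from the definitions (pairing the `±α` terms with
`a_{−α} = −a_α`) and confirms that with THIS `δ` the two sign products are exactly the printed index sets
`{p(α) = p(μ⁻¹α) = p(μ⁻¹σ⁻¹α) = 1, p(σ⁻¹α) = −1}` and `{p(α) = p(σ⁻¹α) = p(μ⁻¹σ⁻¹α) = 1, p(μ⁻¹α) = −1}`, the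
same sets as in (b).

| print (reissue page) | decl | form |
|---|---|---|
| Lemma 2.1.A (p. 11) | `Lemma_2_1_A` | predicate on a given section `n` of a given extension |
| Lemma 2.1.B (p. 12) | `Lemma_2_1_B` | closed, concrete (`groupCohomology.IsCocycle₂`) |
| Lemma 2.1.C (p. 12) | `Lemma_2_1_C` | closed, concrete (`IsCoboundary₂ (t_p − t_q)`) |
| Lemma 2.1.D (p. 12) | `Lemma_2_1_D` | closed, concrete |
| Lemma 2.2.A (p. 13) | `Lemma_2_2_A` | closed, concrete (`t_p = ∂u_p` on `Γ`, diagonal action) |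
| Lemma 2.2.B (p. 13) | `Lemma_2_2_B` | closed, concrete |
| Lemma 2.2.C (a), (b) (p. 13) | `Lemma_2_2_C_a`, `Lemma_2_2_C_b` | closed, concrete |
| Lemma 2.3.A (p. 15) | `Lemma_2_3_A` (corrected in place, ED. 5/7; proved) | closed, concrete COCHAIN FORM (see above) |
| Lemma 2.3.B (a), (b) (p. 16) | `Lemma_2_3_B_a`, `Lemma_2_3_B_b` (the latter corrected in place, ED. 5/7; both proved) | closed, concrete |

ERRATUM (editions 5–7, 2026-09-02).  ED. 1–4 carried a mis-transcribed middle term: in Lemma 2.3.B (b) and in the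
cochain of Lemma 2.3.A the first argument of `μ[t_p(μ⁻¹ω(σ), σ(μ)) …]` was typed `μ⁻¹ω(σ)σ(μ)` (the `Ω`-part of
`σ′_T`) instead of print's `μ⁻¹ω(σ)` (reissue p. 16, both displays).  Those ED. 1–4 statements were NOT the printed
ones and the 2.3.B (b) one is false in general (exhaustive check over the Weyl groups of `A₂`, `B₂`, `A₃` with all
gauges: 40/72, 44/64, 808/1152 failing instances, against 0 for the printed reading; evidence: typer seat TN-t01 g0,
`scratch/check23b.py`).  ED. 5 (2026-09-02) added the printed statements as primed twins with proofs; ED. 7 (squad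
ruling TN-plan 2026-09-02T02:45:58Z: «correct in place, same decl names, no primed twins — a false closed
`def … : Prop` left in the tree is a trap») folds them IN PLACE: `Lemma_2_3_B_b` and `Lemma_2_3_A` now carry the
printed reading and are PROVED below (`Lemma_2_3_B_b_holds`; `Lemma_2_3_A_holds` from `Lemma_2_3_B_a_holds` +
`Lemma_2_3_B_b_holds` with `y = δ⁻¹`, as print says); the primed names of ED. 5–6 are gone.  No other module referred
to either declaration under any of these names at the time of the correction.

## References
* [LanglandsShelstad1987] R. P. Langlands, D. Shelstad, *On the definition of transfer factors*, Math. Ann. 278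
  (1987) 219–271, §2.1–2.3; IAS reissue pp. 10–18 (held: `paper:doi-10-1007-bf01458070`).
-/

noncomputable section

open scoped TensorProduct Pointwise

namespace Literature.NumberTheory.Automorphic.LanglandsShelstad1987.KeyLemmasI

open Literature.NumberTheory.Automorphic.LanglandsShelstad1987

universe u v w x

/-! ## (2.1) General remarks (reissue pp. 10–12) -/

/-- **Lemma 2.1.A** (reissue p. 11).  Setting: `G` connected reductive quasi-split over `k`, `(B, T, {X_α})` a
`k`-splitting preserved by the group `Γ` acting on `G`, `Ω = Ω(G, T)`, and for `θ = ω ⋊ γ ∈ Ω ⋊ Γ` the element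
`n(θ) = n(ω) ⋊ γ ∈ G(k̄) ⋊ Γ` of the Tits section (`n(α) = exp X_α exp(−X_{−α}) exp X_α` for simple `α`,
`n(ω) = n(α₁)⋯n(α_r)` along a reduced word), so that «`n(θ₁)n(θ₂) = t(θ₁, θ₂)n(θ₁θ₂)`, `θ_i ∈ Ω ⋊ Γ`, where
`t(θ₁, θ₂)` is a 2-cocycle of `Ω ⋊ Γ` in `T(k̄)`».  LEMMA: «`t(θ₁, θ₂) = ∏ (−1)^{α^∨}`, the product over the roots
`α > 0` with `θ₁⁻¹α < 0` and `θ₂⁻¹θ₁⁻¹α > 0`.  Here `α > 0` means `α` is a root of `T` in `B`, and `α^∨` is the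
coroot for `α` as element of `X_*(T)`. Then `(−1)^{α^∨} ∈ k̄^× ⊗ X_*(T) ⊆ T(k̄)`.»
TYPED FORM (no reductive groups in Mathlib): a predicate on explicitly GIVEN data — the group `S = Ω ⋊ Γ` acting
on `X = X_*(T)` with the finite `S`-stable set `R ⊂ X` of COROOTS and the gauge `p` with `p(α^∨) = 1 ⇔ α > 0`
(so `θ⁻¹α < 0 ⇔ p(θ⁻¹α^∨) = −1`), a group `E` (for `Norm(T(k̄), G(k̄)) ⋊ Γ`) receiving `T(k̄) = k̄^× ⊗ X` by
`ι` and the section `n : S → E`; it says `n(θ₁) n(θ₂) = ι(t_p(θ₁, θ₂)) n(θ₁θ₂)` for all `θ₁, θ₂`, with `t_p` the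
cochain `tCochain` of (2.1).  A consumer asserts it for the Tits section of ITS group.
[cite: LanglandsShelstad1987, Lemma 2.1.A (reissue p. 11)] -/
def Lemma_2_1_A (S : Type u) [Group S] (X : Type v) [AddCommGroup X] [DistribMulAction S X]
    (K : Type w) [Field K] (R : Finset X) (p : X → ℤˣ)
    (E : Type x) [Group E] (ι : Multiplicative (UnitsTensor X K) →* E) (n : S → E) : Prop :=
  ∀ θ₁ θ₂ : S, n θ₁ * n θ₂ = ι (Multiplicative.ofAdd (tCochain S K R p (θ₁, θ₂))) * n (θ₁ * θ₂)

/-- **Lemma 2.1.B** (reissue p. 12).  Setting (p. 11–12): «Let `X` be a free finitely generated `ℤ`-module and `Σ`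
be a group which acts on `X` and contains an element `ε` sending `λ` to `−λ`, `λ ∈ X`. Then with trivial action of
`k^×`, `Σ` acts on `k^× ⊗ X`. Let `R` be a finite `Σ`-stable subset of `X` and `p` be a gauge on `R` …» (`k` a
field of characteristic zero).  LEMMA: «`t_p(σ, τ) = ∏^p_{1,σ,τ} (−1)^λ`, `σ, τ ∈ Σ`, is a 2-cocycle of `Σ` with
values in `k^× ⊗ X`» — Mathlib's inhomogeneous `groupCohomology.IsCocycle₂` for the action through `X`
(convention (C4)). [cite: LanglandsShelstad1987, Lemma 2.1.B (reissue p. 12)] -/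
def Lemma_2_1_B : Prop :=
  ∀ (S : Type u) [Group S] (X : Type v) [AddCommGroup X] [Module.Free ℤ X] [Module.Finite ℤ X]
    [DistribMulAction S X] (ε : S), (∀ x : X, ε • x = -x) →
  ∀ (k : Type w) [Field k] [CharZero k] (R : Finset X) (p : X → ℤˣ),
    IsStable S X R → IsGauge R p →
    groupCohomology.IsCocycle₂ (tCochain S k R p)

/-- **Lemma 2.1.C** (reissue p. 12), same setting as 2.1.B: «If `q` is also a gauge on `R`, then `t_q` is
cohomologous to `t_p`» — `t_p − t_q` (print: `t_p t_q⁻¹`) is an inhomogeneous 2-coboundary of `Σ` in `k^× ⊗ X`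
(Mathlib `groupCohomology.IsCoboundary₂`). [cite: LanglandsShelstad1987, Lemma 2.1.C (reissue p. 12)] -/
def Lemma_2_1_C : Prop :=
  ∀ (S : Type u) [Group S] (X : Type v) [AddCommGroup X] [Module.Free ℤ X] [Module.Finite ℤ X]
    [DistribMulAction S X] (ε : S), (∀ x : X, ε • x = -x) →
  ∀ (k : Type w) [Field k] [CharZero k] (R : Finset X) (p q : X → ℤˣ),
    IsStable S X R → IsGauge R p → IsGauge R q →
    groupCohomology.IsCoboundary₂ (tCochain S k R p - tCochain S k R q)

/-- **Lemma 2.1.D** (reissue p. 12).  Setting (p. 12): «In the application of (2.3) and (2.6) we will have `ε² = 1`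
and `Σ` will be the product of `{1, ε}` and a subgroup `Γ`. Then if `Σ` acts transitively on `R` either `R` consists
of exactly two `Γ`-orbits `O` and `−O` or `Γ` also acts transitively on `R` … In the former case `O` is called
asymmetric and in the latter symmetric.»  LEMMA: «Suppose that `R = ∪ ±O`, where `O` is asymmetric. Then the
restriction of `t_p` [to `Γ`] is trivial.»  Typed for the group `Γ` acting on `X` (convention (C2): `Σ = Γ × {1,ε}`
acts through `Γ` and `−1`): `R = O ∪ −O` with `O` an asymmetric `Γ`-orbit, `p` a gauge; conclusion: `t_p` on
`Γ × Γ` is a 2-coboundary of `Γ` in `k^× ⊗ X`. [cite: LanglandsShelstad1987, Lemma 2.1.D (reissue p. 12)] -/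
def Lemma_2_1_D : Prop :=
  ∀ (Γ : Type u) [Group Γ] (X : Type v) [AddCommGroup X] [Module.Free ℤ X] [Module.Finite ℤ X]
    [DistribMulAction Γ X] (k : Type w) [Field k] [CharZero k] (R : Finset X) (O : Set X) (p : X → ℤˣ),
    IsAsymmOrbit Γ X O → (R : Set X) = O ∪ -O → IsGauge R p →
    groupCohomology.IsCoboundary₂ (tCochain Γ k R p)

/-! ## (2.2) a-data (reissue pp. 12–13)

Print: «First we consider splitting `t_p` in `k̄^× ⊗ X`, given an extension of the action of `Σ` on `k` to `k̄` with
`ε` acting trivially.»  Typed with `Γ` acting on the algebraically closed field `K` of characteristic zero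
(`[MulSemiringAction Γ K]`) and through it diagonally on `K^× ⊗ X` (`actDiag`, `cobdDiag` of `Defs`). -/

/-- **Lemma 2.2.A** (reissue p. 13): for a-data `{a_λ}` «for the action of `Γ` in `R`» and
`u_p(σ) = ∏^p_{1,σ} a_λ^λ`, `σ ∈ Γ`: «`t_p(σ, τ) = ∂u_p(σ, τ)`, `σ, τ ∈ Γ`», where
«`∂u_p(σ,τ) = u_p(σ)σ(u_p(τ))u_p(στ)⁻¹`» (diagonal action) — i.e. a-data split `t_p` on `Γ` in `k̄^× ⊗ X`.
[cite: LanglandsShelstad1987, Lemma 2.2.A (reissue p. 13)] -/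
def Lemma_2_2_A : Prop :=
  ∀ (Γ : Type u) [Group Γ] (X : Type v) [AddCommGroup X] [Module.Free ℤ X] [Module.Finite ℤ X]
    [DistribMulAction Γ X] (K : Type w) [Field K] [CharZero K] [IsAlgClosed K] [MulSemiringAction Γ K]
    (R : Finset X) (p : X → ℤˣ) (a : X → Kˣ),
    IsStable Γ X R → IsSymm R → IsGauge R p → IsAData Γ X K R a →
    ∀ σ τ : Γ, tCochain Γ K R p (σ, τ) = cobdDiag Γ K (uCochain Γ K R p a) σ τ

/-- **Lemma 2.2.B** (reissue p. 13): «Suppose that `{b_λ : λ ∈ R}` satisfies `b_λ ∈ k̄^×`, `b_{σλ} = σ(b_λ)`,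
`σ ∈ Γ`, and `b_{−λ} = b_λ`. Then `v_p(σ) = ∏^p_{1,σ} b_λ^λ`, `σ ∈ Γ`, is a 1-cocycle of `Γ` in `k̄^× ⊗ X`» —
`v_p(στ) = v_p(σ) σ(v_p(τ))` for the diagonal action (additively). [cite: LanglandsShelstad1987, Lemma 2.2.B (reissue p. 13)] -/
def Lemma_2_2_B : Prop :=
  ∀ (Γ : Type u) [Group Γ] (X : Type v) [AddCommGroup X] [Module.Free ℤ X] [Module.Finite ℤ X]
    [DistribMulAction Γ X] (K : Type w) [Field K] [CharZero K] [IsAlgClosed K] [MulSemiringAction Γ K]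
    (R : Finset X) (p : X → ℤˣ) (b : X → Kˣ),
    IsStable Γ X R → IsSymm R → IsGauge R p → IsBData Γ X K R b →
    ∀ σ τ : Γ, vCochain Γ K R p b (σ * τ) = actDiag Γ X K σ (vCochain Γ K R p b τ) + vCochain Γ K R p b σ

/-- **Lemma 2.2.C (a)** (reissue p. 13), for `b`, `v_p` as in Lemma 2.2.B: «The class of `v_p` is independent of
`p`» — for gauges `p`, `q` the cochain `v_p − v_q` (print `v_p v_q⁻¹`) is a 1-coboundary of `Γ` in `k̄^× ⊗ X`
for the diagonal action: `∃ x, v_p(σ) − v_q(σ) = σ(x) − x`. [cite: LanglandsShelstad1987, Lemma 2.2.C (reissue p. 13)] -/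
def Lemma_2_2_C_a : Prop :=
  ∀ (Γ : Type u) [Group Γ] (X : Type v) [AddCommGroup X] [Module.Free ℤ X] [Module.Finite ℤ X]
    [DistribMulAction Γ X] (K : Type w) [Field K] [CharZero K] [IsAlgClosed K] [MulSemiringAction Γ K]
    (R : Finset X) (p q : X → ℤˣ) (b : X → Kˣ),
    IsStable Γ X R → IsSymm R → IsGauge R p → IsGauge R q → IsBData Γ X K R b →
    ∃ x : UnitsTensor X K, ∀ σ : Γ,
      vCochain Γ K R p b σ - vCochain Γ K R q b σ = actDiag Γ X K σ x - x

/-- **Lemma 2.2.C (b)** (reissue p. 13), for `b`, `v_p` as in Lemma 2.2.B: «if `R = ±O` where `O` is an asymmetric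
`Γ`-orbit then `v_p` is cohomologically trivial» — `∃ x, v_p(σ) = σ(x) − x` for all `σ ∈ Γ` (diagonal action).
[cite: LanglandsShelstad1987, Lemma 2.2.C (reissue p. 13)] -/
def Lemma_2_2_C_b : Prop :=
  ∀ (Γ : Type u) [Group Γ] (X : Type v) [AddCommGroup X] [Module.Free ℤ X] [Module.Finite ℤ X]
    [DistribMulAction Γ X] (K : Type w) [Field K] [CharZero K] [IsAlgClosed K] [MulSemiringAction Γ K]
    (R : Finset X) (O : Set X) (p : X → ℤˣ) (b : X → Kˣ),
    IsAsymmOrbit Γ X O → (R : Set X) = O ∪ -O → IsGauge R p → IsBData Γ X K R b →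
    ∃ x : UnitsTensor X K, ∀ σ : Γ, vCochain Γ K R p b σ = actDiag Γ X K σ x - x

/-! ## (2.3) An application (reissue pp. 14–18): the cochain identities behind `λ(T)`

Setting of (2.3) transcribed: `S = Ω ⋊ Γ` acts on `X = X_*(T)` (`T` the torus of a `k`-splitting `(B, T, {X_α})`
of the simply connected quasi-split `G`) and on `k̄ = K` through `Γ` — so the subgroup `Ω ≤ S` acts trivially on
`K`; `R ⊂ X` is the set of coroots, `p` the gauge «`p(α) = 1` if and only if `α` is a root of `T` in `B`» — so `p`
is `Γ`-invariant («we observe first that `p(σ⁻¹α) = p(α)`», p. 17, `σ` acting through `Γ`); `σ_T = ω_T(σ) ⋊ σ`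
is the transported action of `σ ∈ Γ` (p. 14), an element `s = ω · γ` of `S` with `ω ∈ Ω`, `γ ∈ Γ`, and
`Γ_T = {σ_T}`; a-data for `T` are a-data for the action of `Γ_T` on `R` (p. 14); `x(σ_T) = ∏^p_{1,σ} a_α^{α^∨}`
(p. 14) is `uCochain … s`; `μ ∈ Ω` is the Weyl element of (2.3.3) (p. 15), `σ′_T = μ⁻¹ ω_T(σ) σ(μ) ⋊ σ =
μ⁻¹ σ_T μ`, and the transported a-data are `a′_α = a_{μα}` (p. 15).  `μ(·)` is the action of `μ` through `X`
(the instance action), `σ(·) = σ_T(·)` the diagonal action `actDiag … s`. -/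

/-- **Lemma 2.3.B (a)** (reissue p. 16), in the setting above: «Let `δ = ∏^p_{1,μ} a_α^{−α^∨}` [product over `α`
with `p(α) = 1`, `p(μ⁻¹α) = −1`]. Then `μ(x(σ′))x(σ)⁻¹` is equal to
`δσ(δ⁻¹) · ∏_{p(α)=p(μ⁻¹α)=p(μ⁻¹σ⁻¹α)=1, p(σ⁻¹α)=−1} (−1)^{α^∨} · ∏_{p(α)=p(σ⁻¹α)=p(μ⁻¹σ⁻¹α)=1, p(μ⁻¹α)=−1}
(−1)^{α^∨}`» (subscript `T` omitted: `σ = σ_T = s`, `σ′ = μ⁻¹ s μ`, `x = u_p`, `a′ = a ∘ μ`; additively).  See the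
READING NOTE in the module docstring for `δ`. [cite: LanglandsShelstad1987, Lemma 2.3.B (reissue p. 16)] -/
def Lemma_2_3_B_a : Prop :=
  ∀ (S : Type u) [Group S] (X : Type v) [AddCommGroup X] [Module.Free ℤ X] [Module.Finite ℤ X]
    [DistribMulAction S X] (K : Type w) [Field K] [CharZero K] [IsAlgClosed K] [MulSemiringAction S K]
    (Ω ΓT : Subgroup S) (R : Finset X) (p : X → ℤˣ) (a : X → Kˣ) (μ s : S),
    IsStable S X R → IsSymm R → IsGauge R p → (∀ w ∈ Ω, ∀ c : K, w • c = c) → μ ∈ Ω → s ∈ ΓT →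
    IsAData ΓT X K R a →
    μ • uCochain S K R p (fun l => a (μ • l)) (μ⁻¹ * s * μ) - uCochain S K R p a s =
      ((∑ l ∈ R with (p l = 1 ∧ p (μ⁻¹ • l) = -1), -unitPow (a l) l)
        - actDiag S X K s (∑ l ∈ R with (p l = 1 ∧ p (μ⁻¹ • l) = -1), -unitPow (a l) l))
      + (∑ l ∈ R with (p l = 1 ∧ p (μ⁻¹ • l) = 1 ∧ p (μ⁻¹ • s⁻¹ • l) = 1 ∧ p (s⁻¹ • l) = -1),
          unitPow (-1 : Kˣ) l)
      + (∑ l ∈ R with (p l = 1 ∧ p (s⁻¹ • l) = 1 ∧ p (μ⁻¹ • s⁻¹ • l) = 1 ∧ p (μ⁻¹ • l) = -1),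
          unitPow (-1 : Kˣ) l)

/-- **Lemma 2.3.B (b)** (reissue p. 16; statement CORRECTED IN PLACE at ED. 5/7 — see the ERRATUM in the module
docstring).  In the setting above, with `s = σ_T = ω(σ) ⋊ σ` written `s = ω * γ`
(`ω = ω(σ) ∈ Ω`, `γ ∈ Γ` the Galois part, `σ(μ) = γ μ γ⁻¹`) and `p` `Γ`-invariant:
«`t_p(μ, μ⁻¹) μ[t_p(μ⁻¹ω(σ), σ(μ)) t_p(μ⁻¹, ω(σ))]` is equal to
`∏_{p(α)=p(μ⁻¹α)=p(μ⁻¹σ⁻¹α)=1, p(σ⁻¹α)=−1} (−1)^{α^∨} · ∏_{p(α)=p(σ⁻¹α)=p(μ⁻¹σ⁻¹α)=1, p(μ⁻¹α)=−1} (−1)^{α^∨}`»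
(additively; `t_p` with values in `k̄^× ⊗ X`; the middle cochain is `t_p` at the pair `(μ⁻¹ω(σ), σ(μ)) =
(μ⁻¹ * ω, γ * μ * γ⁻¹)`).  Proved below (`Lemma_2_3_B_b_holds`).
[cite: LanglandsShelstad1987, Lemma 2.3.B (reissue p. 16)] -/
def Lemma_2_3_B_b : Prop :=
  ∀ (S : Type u) [Group S] (X : Type v) [AddCommGroup X] [Module.Free ℤ X] [Module.Finite ℤ X]
    [DistribMulAction S X] (K : Type w) [Field K] [CharZero K] [IsAlgClosed K]
    (Ω Γ : Subgroup S) (R : Finset X) (p : X → ℤˣ) (μ ω γ : S),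
    IsStable S X R → IsSymm R → IsGauge R p → μ ∈ Ω → ω ∈ Ω → γ ∈ Γ →
    (∀ g ∈ Γ, ∀ l ∈ R, p (g • l) = p l) →
    tCochain S K R p (μ, μ⁻¹)
        + μ • (tCochain S K R p (μ⁻¹ * ω, γ * μ * γ⁻¹) + tCochain S K R p (μ⁻¹, ω)) =
      (∑ l ∈ R with (p l = 1 ∧ p (μ⁻¹ • l) = 1 ∧ p (μ⁻¹ • (ω * γ)⁻¹ • l) = 1 ∧ p ((ω * γ)⁻¹ • l) = -1),
          unitPow (-1 : Kˣ) l)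
      + (∑ l ∈ R with (p l = 1 ∧ p ((ω * γ)⁻¹ • l) = 1 ∧ p (μ⁻¹ • (ω * γ)⁻¹ • l) = 1 ∧ p (μ⁻¹ • l) = -1),
          unitPow (-1 : Kˣ) l)

/-- **Lemma 2.3.A** (reissue p. 15: «The cocycle `b` is trivial»), COCHAIN FORM (statement CORRECTED IN PLACE at
ED. 5/7 — see the ERRATUM in the module docstring; proved below, `Lemma_2_3_A_holds`).  In (2.3.3) (p. 15) the Borel subgroup
`B ⊃ T` is replaced by `vBv⁻¹`, `u = h⁻¹vh ∈ Norm(T, G)` represents `μ ∈ Ω`, and `u m(σ′_T) σ(u)⁻¹ = b(σ_T) m(σ_T)`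
defines a 1-cocycle `b` of `Γ_T` with values in `T`; the lemma asserts that `b` is cohomologically trivial, whence
`λ(T)` is independent of `B`.  Print computes (p. 16): «`b(σ_T)` is equivalent to
`μ(x(σ′_T))x(σ_T)⁻¹ t_p(μ, μ⁻¹) μ[t_p(μ⁻¹ω_T(σ), σ(μ)) t_p(μ⁻¹, ω_T(σ))]`» (equal up to the coboundary
`λ⁻¹σ_T(λ)`), and «That `b(σ)` is trivial follows from: Lemma 2.3.B».  The group elements `m`, `n`, `u` live in
`G(k̄)` (no Mathlib notion); what is typed is the EQUIVALENT cochain statement: for `σ_T = ω_T(σ)γ_σ ∈ Γ_T`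
(`ω_T(σ) ∈ Ω`, `γ_σ ∈ Γ`, `σ(μ) = γ_σ μ γ_σ⁻¹`), the explicit 1-cochain of `Γ_T` displayed above — middle term
`t_p` at the pair `(μ⁻¹ω_T(σ), σ(μ)) = (μ⁻¹ * ωT s, γT s * μ * (γT s)⁻¹)` — with values in `k̄^× ⊗ X`
(additively), is a 1-coboundary for the diagonal action: `∃ y, c(σ_T) = σ_T(y) − y` on `Γ_T`.
[cite: LanglandsShelstad1987, Lemma 2.3.A (reissue pp. 15–16)] -/
def Lemma_2_3_A : Prop :=
  ∀ (S : Type u) [Group S] (X : Type v) [AddCommGroup X] [Module.Free ℤ X] [Module.Finite ℤ X]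
    [DistribMulAction S X] (K : Type w) [Field K] [CharZero K] [IsAlgClosed K] [MulSemiringAction S K]
    (Ω Γ ΓT : Subgroup S) (R : Finset X) (p : X → ℤˣ) (a : X → Kˣ) (μ : S) (ωT γT : S → S),
    IsStable S X R → IsSymm R → IsGauge R p → (∀ w ∈ Ω, ∀ c : K, w • c = c) → μ ∈ Ω →
    (∀ g ∈ Γ, ∀ l ∈ R, p (g • l) = p l) → IsAData ΓT X K R a →
    (∀ s ∈ ΓT, ωT s ∈ Ω ∧ γT s ∈ Γ ∧ s = ωT s * γT s) →
    ∃ y : UnitsTensor X K, ∀ s ∈ ΓT,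
      (μ • uCochain S K R p (fun l => a (μ • l)) (μ⁻¹ * s * μ) - uCochain S K R p a s)
        + (tCochain S K R p (μ, μ⁻¹)
          + μ • (tCochain S K R p (μ⁻¹ * ωT s, γT s * μ * (γT s)⁻¹)
            + tCochain S K R p (μ⁻¹, ωT s))) =
      actDiag S X K s y - y

/-! ## Discharges (proof lane; statements above unchanged) -/

/-- **Lemma 2.2.B holds** (reissue p. 13 / Math. Ann. 278 p. 230): `v_p` is a 1-cocycle of `Γ` in `k̄^× ⊗ X` for the
diagonal action.  Proof (the printed «by simply modifying the proof [of 2.2.A]»): `σ(b_λ^λ) = b_{σλ}^{σλ}` by (i) of the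
datum, so `σ(v_p(τ))` is the same sum re-indexed by `λ ↦ σλ`; collecting the three sums over `R` by the sign pattern
`(p(λ), p(σ⁻¹λ), p(τ⁻¹σ⁻¹λ))`, only the patterns `(−,+,−)` and `(+,−,+)` survive, and these cancel in pairs
`λ ↔ −λ` because `b_{−λ}^{−λ} = (b_λ^λ)⁻¹` by (ii) (`Finset.sum_involution`).
[cite: LanglandsShelstad1987, Lemma 2.2.B (reissue p. 13)] -/
theorem Lemma_2_2_B_holds : Lemma_2_2_B := by
  intro Γ _ X _ _ _ _ K _ _ _ _ R p b hst hsy hga hb σ τ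
  -- (F2) `b_{-λ}^{-λ} = (b_λ^λ)⁻¹` on `R`
  have hneg : ∀ l ∈ R, unitPow (b (-l)) (-l) = -(unitPow (b l) l : UnitsTensor X K) := by
    intro l hl
    simp only [unitPow, hb.2 l hl, TensorProduct.neg_tmul]
  -- (F1) `σ(b_λ^λ) = b_{σλ}^{σλ}` on `R`
  have hact : ∀ l ∈ R, actDiag Γ X K σ (unitPow (b l) l) = unitPow (b (σ • l)) (σ • l) := by
    intro l hl
    have hu : unitsGalAct Γ K σ (b l) = b (σ • l) := by
      ext
      simp [unitsGalAct, hb.1 σ l hl]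
    simp [actDiag, unitPow, TensorProduct.map_tmul, hu]
  -- Step 1: `σ(v_p(τ)) = ∑_{p(σ⁻¹λ)=1, p(τ⁻¹σ⁻¹λ)=-1} b_λ^λ` (reindex `λ ↦ σλ`)
  have h1 : actDiag Γ X K σ (vCochain Γ K R p b τ) =
      ∑ m ∈ R with (p (σ⁻¹ • m) = 1 ∧ p (τ⁻¹ • σ⁻¹ • m) = -1), unitPow (b m) m := by
    unfold vCochain
    rw [map_sum]
    have hc : ∀ l ∈ R.filter (fun l => p l = 1 ∧ p (τ⁻¹ • l) = -1),
        actDiag Γ X K σ (unitPow (b l) l) = unitPow (b (σ • l)) (σ • l) :=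
      fun l hl => hact l (Finset.mem_filter.1 hl).1
    rw [Finset.sum_congr rfl hc]
    apply Finset.sum_nbij' (fun l => σ • l) (fun m => σ⁻¹ • m)
    · intro l hl
      simp only [Finset.mem_filter] at hl ⊢
      exact ⟨hst σ l hl.1, by simpa [inv_smul_smul] using hl.2.1, by simpa [inv_smul_smul] using hl.2.2⟩
    · intro m hm
      simp only [Finset.mem_filter] at hm ⊢
      exact ⟨hst σ⁻¹ m hm.1, hm.2.1, hm.2.2⟩
    · intro l hl
      simp
    · intro m hm
      simp
    · intro l hl
      simp
  -- Step 2: `v_p(στ)` with `(στ)⁻¹λ = τ⁻¹σ⁻¹λ`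
  have h2 : vCochain Γ K R p b (σ * τ) =
      ∑ m ∈ R with (p m = 1 ∧ p (τ⁻¹ • σ⁻¹ • m) = -1), unitPow (b m) m := by
    simp only [vCochain, mul_inv_rev, mul_smul]
  rw [h1, h2]
  unfold vCochain
  simp only [Finset.sum_filter]
  rw [← Finset.sum_add_distrib, ← sub_eq_zero, ← Finset.sum_sub_distrib]
  have c1 : (-1 : ℤˣ) ≠ 1 := by decide
  have c2 : (1 : ℤˣ) ≠ -1 := by decide
  refine Finset.sum_involution (fun m _ => -m) ?_ ?_ ?_ ?_
  · intro m hm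
    have hs : σ⁻¹ • m ∈ R := hst σ⁻¹ m hm
    have hts : τ⁻¹ • σ⁻¹ • m ∈ R := hst τ⁻¹ _ hs
    have e1 : p (-m) = -p m := hga m hm
    have e2 : p (σ⁻¹ • -m) = -p (σ⁻¹ • m) := by rw [smul_neg]; exact hga _ hs
    have e3 : p (τ⁻¹ • σ⁻¹ • -m) = -p (τ⁻¹ • σ⁻¹ • m) := by rw [smul_neg, smul_neg]; exact hga _ hts
    rw [e1, e2, e3, hneg m hm]
    rcases Int.units_eq_one_or (p m) with k1 | k1 <;>
    rcases Int.units_eq_one_or (p (σ⁻¹ • m)) with k2 | k2 <;>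
    rcases Int.units_eq_one_or (p (τ⁻¹ • σ⁻¹ • m)) with k3 | k3 <;>
    simp [k1, k2, k3, c1, c2]
  · intro m hm _ h
    have := hga m hm
    rw [h] at this
    exact units_ne_neg_self (p m) this
  · intro m hm
    exact hsy m hm
  · intro m hm
    simp

/-- **Lemma 2.2.A holds** (reissue p. 13 / Math. Ann. 278 p. 230): a-data split `t_p` on `Γ` in `k̄^× ⊗ X`,
`t_p = ∂u_p`.  Proof as printed («Fix `λ ∈ R` with `p(λ) = 1`. Then the contributions of the terms with exponents `±λ`
are as follows (i)–(iv)»): `σ(a_λ^λ) = a_{σλ}^{σλ}` by (i), so `σ(u_p(τ))` is re-indexed by `λ ↦ σλ`; collecting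
`∂u_p − t_p` over `R` by the sign pattern `(p(λ), p(σ⁻¹λ), p(τ⁻¹σ⁻¹λ))`, the terms pair off under `λ ↔ −λ` using
`a_{−λ}^{−λ} = (−1)^{−λ} a_λ^{−λ}` (from (ii)) and `(−1)^{2λ} = 1` (`Finset.sum_involution`).
[cite: LanglandsShelstad1987, Lemma 2.2.A (reissue p. 13)] -/
theorem Lemma_2_2_A_holds : Lemma_2_2_A := by
  intro Γ _ X _ _ _ _ K _ _ _ _ R p a hst hsy hga ha σ τ
  -- `(-1)^λ` has order two
  have hs2 : ∀ m : X, unitPow (-1 : Kˣ) m + unitPow (-1 : Kˣ) m = 0 := by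
    intro m
    simp only [unitPow, ← TensorProduct.tmul_add, ← ofMul_mul]
    simp
  have hs2z : ∀ m : X, (2 : ℤ) • unitPow (-1 : Kˣ) m = 0 := by
    intro m
    rw [two_zsmul]
    exact hs2 m
  have hsneg : ∀ m : X, unitPow (-1 : Kˣ) (-m) = -unitPow (-1 : Kˣ) m := by
    intro m
    simp only [unitPow, TensorProduct.neg_tmul]
  -- `a_{-λ}^{-λ} = (-1)^λ⁻¹ · (a_λ^λ)⁻¹`, additively
  have hnegA : ∀ l ∈ R, unitPow (a (-l)) (-l) = -unitPow (-1 : Kˣ) l - unitPow (a l) l := by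
    intro l hl
    have hu : a (-l) = -1 * a l := by
      ext
      simp [ha.2 l hl]
    simp only [unitPow, hu, ofMul_mul, TensorProduct.tmul_add, TensorProduct.neg_tmul]
    abel
  -- `σ(a_λ^λ) = a_{σλ}^{σλ}` on `R`
  have hact : ∀ l ∈ R, actDiag Γ X K σ (unitPow (a l) l) = unitPow (a (σ • l)) (σ • l) := by
    intro l hl
    have hu : unitsGalAct Γ K σ (a l) = a (σ • l) := by
      ext
      simp [unitsGalAct, ha.1 σ l hl]
    simp [actDiag, unitPow, TensorProduct.map_tmul, hu]
  -- `σ(u_p(τ))` re-indexed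
  have h1 : actDiag Γ X K σ (uCochain Γ K R p a τ) =
      ∑ m ∈ R with (p (σ⁻¹ • m) = 1 ∧ p (τ⁻¹ • σ⁻¹ • m) = -1), unitPow (a m) m := by
    unfold uCochain
    rw [map_sum]
    have hc : ∀ l ∈ R.filter (fun l => p l = 1 ∧ p (τ⁻¹ • l) = -1),
        actDiag Γ X K σ (unitPow (a l) l) = unitPow (a (σ • l)) (σ • l) :=
      fun l hl => hact l (Finset.mem_filter.1 hl).1
    rw [Finset.sum_congr rfl hc]
    apply Finset.sum_nbij' (fun l => σ • l) (fun m => σ⁻¹ • m)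
    · intro l hl
      simp only [Finset.mem_filter] at hl ⊢
      exact ⟨hst σ l hl.1, by simpa [inv_smul_smul] using hl.2.1, by simpa [inv_smul_smul] using hl.2.2⟩
    · intro m hm
      simp only [Finset.mem_filter] at hm ⊢
      exact ⟨hst σ⁻¹ m hm.1, hm.2.1, hm.2.2⟩
    · intro l hl
      simp
    · intro m hm
      simp
    · intro l hl
      simp
  have h2 : uCochain Γ K R p a (σ * τ) =
      ∑ m ∈ R with (p m = 1 ∧ p (τ⁻¹ • σ⁻¹ • m) = -1), unitPow (a m) m := by
    simp only [uCochain, mul_inv_rev, mul_smul]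
  unfold cobdDiag
  rw [h1, h2]
  unfold tCochain uCochain
  simp only [Finset.sum_filter]
  rw [← Finset.sum_sub_distrib, ← Finset.sum_add_distrib, ← sub_eq_zero, ← Finset.sum_sub_distrib]
  have c1 : (-1 : ℤˣ) ≠ 1 := by decide
  have c2 : (1 : ℤˣ) ≠ -1 := by decide
  refine Finset.sum_involution (fun m _ => -m) ?_ ?_ ?_ ?_
  · intro m hm
    have hs : σ⁻¹ • m ∈ R := hst σ⁻¹ m hm
    have hts : τ⁻¹ • σ⁻¹ • m ∈ R := hst τ⁻¹ _ hs
    have e1 : p (-m) = -p m := hga m hm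
    have e2 : p (σ⁻¹ • -m) = -p (σ⁻¹ • m) := by rw [smul_neg]; exact hga _ hs
    have e3 : p (τ⁻¹ • σ⁻¹ • -m) = -p (τ⁻¹ • σ⁻¹ • m) := by rw [smul_neg, smul_neg]; exact hga _ hts
    rw [e1, e2, e3, hnegA m hm, hsneg m]
    rcases Int.units_eq_one_or (p m) with k1 | k1 <;>
    rcases Int.units_eq_one_or (p (σ⁻¹ • m)) with k2 | k2 <;>
    rcases Int.units_eq_one_or (p (τ⁻¹ • σ⁻¹ • m)) with k3 | k3 <;>
      (simp [k1, k2, k3, c1, c2]; try (abel_nf; simp [hs2z]))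
  · intro m hm _ h
    have := hga m hm
    rw [h] at this
    exact units_ne_neg_self (p m) this
  · intro m hm
    exact hsy m hm
  · intro m hm
    simp

/-- **Lemma 2.1.B holds** (reissue p. 12 / Math. Ann. 278 p. 229): `t_p` is a 2-cocycle of `Σ` in `k^× ⊗ X`.  Print's
proof counts, for each `λ` with `p(λ) = 1`, the parity of the number `N` of the four triples on which `p` alternates;
here: `σ(t_p(τ, υ))` is re-indexed by `λ ↦ σλ`, the four sums are collected over `R` by the sign pattern
`(p(λ), p(σ⁻¹λ), p(τ⁻¹σ⁻¹λ), p(υ⁻¹τ⁻¹σ⁻¹λ))`, and the terms pair off under `λ ↔ −λ` since `(−1)^{−λ} = (−1)^λ`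
(`Finset.sum_involution`). [cite: LanglandsShelstad1987, Lemma 2.1.B (reissue p. 12)] -/
theorem Lemma_2_1_B_holds : Lemma_2_1_B := by
  intro S _ X _ _ _ _ ε hε k _ _ R p hst hga
  have hsy : IsSymm R := fun l hl => by simpa [hε] using hst ε l hl
  unfold groupCohomology.IsCocycle₂
  intro g h j
  -- `(-1)^λ` has order two, so `(-1)^{-λ} = (-1)^λ`
  have hs2 : ∀ m : X, unitPow (-1 : kˣ) m + unitPow (-1 : kˣ) m = 0 := by
    intro m
    simp only [unitPow, ← TensorProduct.tmul_add, ← ofMul_mul]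
    simp
  have hsneg : ∀ m : X, unitPow (-1 : kˣ) (-m) = unitPow (-1 : kˣ) m := by
    intro m
    rw [← sub_eq_zero, unitPow, unitPow, TensorProduct.neg_tmul, sub_eq_add_neg, ← neg_add, neg_eq_zero]
    exact hs2 m
  -- the action through `X`: `g(-1)^λ = (-1)^{gλ}`
  have hact : ∀ l : X, g • unitPow (-1 : kˣ) l = unitPow (-1 : kˣ) (g • l) := by
    intro l
    simp [unitPow, TensorProduct.smul_tmul']
  -- `g • t_p(h, j)` re-indexed by `λ ↦ gλ`
  have h1 : g • tCochain S k R p (h, j) =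
      ∑ m ∈ R with (p (g⁻¹ • m) = 1 ∧ p (h⁻¹ • g⁻¹ • m) = -1 ∧ p (j⁻¹ • h⁻¹ • g⁻¹ • m) = 1),
        unitPow (-1 : kˣ) m := by
    unfold tCochain
    rw [Finset.smul_sum]
    simp only [hact]
    apply Finset.sum_nbij' (fun l => g • l) (fun m => g⁻¹ • m)
    · intro l hl
      simp only [Finset.mem_filter] at hl ⊢
      refine ⟨hst g l hl.1, ?_, ?_, ?_⟩
      · simpa [inv_smul_smul] using hl.2.1
      · simpa [inv_smul_smul] using hl.2.2.1
      · simpa [inv_smul_smul] using hl.2.2.2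
    · intro m hm
      simp only [Finset.mem_filter] at hm ⊢
      exact ⟨hst g⁻¹ m hm.1, hm.2.1, hm.2.2.1, hm.2.2.2⟩
    · intro l hl
      simp
    · intro m hm
      simp
    · intro l hl
      simp
  rw [h1]
  simp only [tCochain, mul_inv_rev, mul_smul, Finset.sum_filter]
  rw [← Finset.sum_add_distrib, ← Finset.sum_add_distrib, ← sub_eq_zero, ← Finset.sum_sub_distrib]
  have c1 : (-1 : ℤˣ) ≠ 1 := by decide
  have c2 : (1 : ℤˣ) ≠ -1 := by decide
  refine Finset.sum_involution (fun m _ => -m) ?_ ?_ ?_ ?_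
  · intro m hm
    have hg : g⁻¹ • m ∈ R := hst g⁻¹ m hm
    have hhg : h⁻¹ • g⁻¹ • m ∈ R := hst h⁻¹ _ hg
    have hjhg : j⁻¹ • h⁻¹ • g⁻¹ • m ∈ R := hst j⁻¹ _ hhg
    have e1 : p (-m) = -p m := hga m hm
    have e2 : p (g⁻¹ • -m) = -p (g⁻¹ • m) := by rw [smul_neg]; exact hga _ hg
    have e3 : p (h⁻¹ • g⁻¹ • -m) = -p (h⁻¹ • g⁻¹ • m) := by rw [smul_neg, smul_neg]; exact hga _ hhg
    have e4 : p (j⁻¹ • h⁻¹ • g⁻¹ • -m) = -p (j⁻¹ • h⁻¹ • g⁻¹ • m) := by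
      rw [smul_neg, smul_neg, smul_neg]; exact hga _ hjhg
    rw [e1, e2, e3, e4, hsneg m]
    rcases Int.units_eq_one_or (p m) with k1 | k1 <;>
    rcases Int.units_eq_one_or (p (g⁻¹ • m)) with k2 | k2 <;>
    rcases Int.units_eq_one_or (p (h⁻¹ • g⁻¹ • m)) with k3 | k3 <;>
    rcases Int.units_eq_one_or (p (j⁻¹ • h⁻¹ • g⁻¹ • m)) with k4 | k4 <;>
      simp [k1, k2, k3, k4, c1, c2]
  · intro m hm _ hmm
    have := hga m hm
    rw [hmm] at this
    exact units_ne_neg_self (p m) this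
  · intro m hm
    exact hsy m hm
  · intro m hm
    simp

/-- The explicit splitting `s_{p/q}` of (2.4) (reissue p. 18), written for ANY group `S` acting on `X` (print states it
for `σ ∈ Γ`; the formula and Lemma 2.4.A's sign count are formal in `σ`): the sum of `(−1)^λ` over `λ ∈ R` with
`p(λ) = 1, p(σ⁻¹λ) = −1, q(λ) = q(σ⁻¹λ) = 1` or with `p(λ) = p(σ⁻¹λ) = 1, q(λ) = −1, q(σ⁻¹λ) = 1`.  Internal to the
discharges below (TN-t02's ★ `KeyLemmasII.sCochain` is the same cochain for `Γ`; not imported here to keep the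
import graph of this file unchanged). [cite: LanglandsShelstad1987, §2.4 (reissue p. 18)] -/
def splitCochain {S : Type*} [Group S] {X : Type*} [AddCommGroup X] [DistribMulAction S X] (k : Type*) [Field k]
    (R : Finset X) (p q : X → ℤˣ) (σ : S) : UnitsTensor X k :=
  (∑ l ∈ R with (p l = 1 ∧ p (σ⁻¹ • l) = -1 ∧ q l = 1 ∧ q (σ⁻¹ • l) = 1), unitPow (-1 : kˣ) l) +
    ∑ l ∈ R with (p l = 1 ∧ p (σ⁻¹ • l) = 1 ∧ q l = -1 ∧ q (σ⁻¹ • l) = 1), unitPow (-1 : kˣ) l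

/-- **The coboundary of `s_{p/q}` is `t_p/t_q`** for any group `S` acting on `X` with `R` `S`-stable and symmetric
and `p`, `q` gauges (Lemma 2.4.A's computation, reissue pp. 18–19, valid verbatim for `σ, τ ∈ Σ`): additively
`σ·s(τ) − s(στ) + s(σ) = t_p(σ,τ) − t_q(σ,τ)`.  Proof: collect over `R` by the six signs
`S(λ) = (p(λ), p(σ⁻¹λ), p(τ⁻¹σ⁻¹λ), q(λ), q(σ⁻¹λ), q(τ⁻¹σ⁻¹λ))` and pair `λ ↔ −λ` (`(−1)^{−λ} = (−1)^λ`).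
[cite: LanglandsShelstad1987, Lemma 2.4.A (reissue pp. 18–19)] -/
theorem cobd_splitCochain {S : Type*} [Group S] {X : Type*} [AddCommGroup X] [DistribMulAction S X]
    (k : Type*) [Field k] [CharZero k] (R : Finset X) (p q : X → ℤˣ)
    (hst : IsStable S X R) (hsy : IsSymm R) (hp : IsGauge R p) (hq : IsGauge R q) (σ τ : S) :
    σ • splitCochain k R p q τ - splitCochain k R p q (σ * τ) + splitCochain k R p q σ =
      tCochain S k R p (σ, τ) - tCochain S k R q (σ, τ) := by
  have hs2 : ∀ m : X, unitPow (-1 : kˣ) m + unitPow (-1 : kˣ) m = 0 := by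
    intro m
    simp only [unitPow, ← TensorProduct.tmul_add, ← ofMul_mul]
    simp
  have hs2z : ∀ m : X, (2 : ℤ) • unitPow (-1 : kˣ) m = 0 := by
    intro m
    rw [two_zsmul]
    exact hs2 m
  have hsneg : ∀ m : X, unitPow (-1 : kˣ) (-m) = unitPow (-1 : kˣ) m := by
    intro m
    rw [← sub_eq_zero, unitPow, unitPow, TensorProduct.neg_tmul, sub_eq_add_neg, ← neg_add, neg_eq_zero]
    exact hs2 m
  have hact : ∀ l : X, σ • unitPow (-1 : kˣ) l = unitPow (-1 : kˣ) (σ • l) := by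
    intro l
    simp [unitPow, TensorProduct.smul_tmul']
  -- re-index `σ • s(τ)`
  have h1 : σ • splitCochain k R p q τ =
      (∑ m ∈ R with (p (σ⁻¹ • m) = 1 ∧ p (τ⁻¹ • σ⁻¹ • m) = -1 ∧ q (σ⁻¹ • m) = 1 ∧ q (τ⁻¹ • σ⁻¹ • m) = 1),
          unitPow (-1 : kˣ) m) +
        ∑ m ∈ R with (p (σ⁻¹ • m) = 1 ∧ p (τ⁻¹ • σ⁻¹ • m) = 1 ∧ q (σ⁻¹ • m) = -1 ∧ q (τ⁻¹ • σ⁻¹ • m) = 1),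
          unitPow (-1 : kˣ) m := by
    unfold splitCochain
    rw [smul_add, Finset.smul_sum, Finset.smul_sum]
    simp only [hact]
    congr 1
    · apply Finset.sum_nbij' (fun l => σ • l) (fun m => σ⁻¹ • m)
      · intro l hl
        simp only [Finset.mem_filter] at hl ⊢
        refine ⟨hst σ l hl.1, ?_, ?_, ?_, ?_⟩
        · simpa [inv_smul_smul] using hl.2.1
        · simpa [inv_smul_smul] using hl.2.2.1
        · simpa [inv_smul_smul] using hl.2.2.2.1
        · simpa [inv_smul_smul] using hl.2.2.2.2
      · intro m hm
        simp only [Finset.mem_filter] at hm ⊢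
        exact ⟨hst σ⁻¹ m hm.1, hm.2.1, hm.2.2.1, hm.2.2.2.1, hm.2.2.2.2⟩
      · intro l hl
        simp
      · intro m hm
        simp
      · intro l hl
        simp
    · apply Finset.sum_nbij' (fun l => σ • l) (fun m => σ⁻¹ • m)
      · intro l hl
        simp only [Finset.mem_filter] at hl ⊢
        refine ⟨hst σ l hl.1, ?_, ?_, ?_, ?_⟩
        · simpa [inv_smul_smul] using hl.2.1
        · simpa [inv_smul_smul] using hl.2.2.1
        · simpa [inv_smul_smul] using hl.2.2.2.1
        · simpa [inv_smul_smul] using hl.2.2.2.2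
      · intro m hm
        simp only [Finset.mem_filter] at hm ⊢
        exact ⟨hst σ⁻¹ m hm.1, hm.2.1, hm.2.2.1, hm.2.2.2.1, hm.2.2.2.2⟩
      · intro l hl
        simp
      · intro m hm
        simp
      · intro l hl
        simp
  rw [h1]
  simp only [splitCochain, tCochain, mul_inv_rev, mul_smul, Finset.sum_filter]
  rw [← Finset.sum_add_distrib, ← Finset.sum_add_distrib, ← Finset.sum_add_distrib, ← Finset.sum_sub_distrib,
    ← Finset.sum_add_distrib, ← Finset.sum_sub_distrib, ← sub_eq_zero, ← Finset.sum_sub_distrib]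
  have c1 : (-1 : ℤˣ) ≠ 1 := by decide
  have c2 : (1 : ℤˣ) ≠ -1 := by decide
  refine Finset.sum_involution (fun m _ => -m) ?_ ?_ ?_ ?_
  · intro m hm
    have hg : σ⁻¹ • m ∈ R := hst σ⁻¹ m hm
    have hhg : τ⁻¹ • σ⁻¹ • m ∈ R := hst τ⁻¹ _ hg
    have e1 : p (-m) = -p m := hp m hm
    have e2 : p (σ⁻¹ • -m) = -p (σ⁻¹ • m) := by rw [smul_neg]; exact hp _ hg
    have e3 : p (τ⁻¹ • σ⁻¹ • -m) = -p (τ⁻¹ • σ⁻¹ • m) := by rw [smul_neg, smul_neg]; exact hp _ hhg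
    have f1 : q (-m) = -q m := hq m hm
    have f2 : q (σ⁻¹ • -m) = -q (σ⁻¹ • m) := by rw [smul_neg]; exact hq _ hg
    have f3 : q (τ⁻¹ • σ⁻¹ • -m) = -q (τ⁻¹ • σ⁻¹ • m) := by rw [smul_neg, smul_neg]; exact hq _ hhg
    rw [e1, e2, e3, f1, f2, f3, hsneg m]
    rcases Int.units_eq_one_or (p m) with k1 | k1 <;>
    rcases Int.units_eq_one_or (p (σ⁻¹ • m)) with k2 | k2 <;>
    rcases Int.units_eq_one_or (p (τ⁻¹ • σ⁻¹ • m)) with k3 | k3 <;>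
    rcases Int.units_eq_one_or (q m) with k4 | k4 <;>
    rcases Int.units_eq_one_or (q (σ⁻¹ • m)) with k5 | k5 <;>
    rcases Int.units_eq_one_or (q (τ⁻¹ • σ⁻¹ • m)) with k6 | k6 <;>
      (simp [k1, k2, k3, k4, k5, k6, c1, c2, hs2]; try (abel_nf; simp [hs2z]))
  · intro m hm _ hmm
    have := hp m hm
    rw [hmm] at this
    exact units_ne_neg_self (p m) this
  · intro m hm
    exact hsy m hm
  · intro m hm
    simp

/-- **Lemma 2.1.C holds**: `t_p − t_q = ∂s_{p/q}` on all of `Σ` (`cobd_splitCochain`), so `t_q` is cohomologous to `t_p`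
in `k^× ⊗ X`. [cite: LanglandsShelstad1987, Lemma 2.1.C (reissue p. 12)] -/
theorem Lemma_2_1_C_holds : Lemma_2_1_C := by
  intro S _ X _ _ _ _ ε hε k _ _ R p q hst hp hq
  have hsy : IsSymm R := fun l hl => by simpa [hε] using hst ε l hl
  refine ⟨splitCochain k R p q, fun g h => ?_⟩
  simpa using cobd_splitCochain k R p q hst hsy hp hq g h

/-- **Lemma 2.1.D holds**: for `R = 𝒪 ∪ −𝒪` with `𝒪` an asymmetric `Γ`-orbit, the gauge `q = 1` on `𝒪`, `−1` off `𝒪`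
is `Γ`-invariant, so `t_q = 0` and `t_p = t_p − t_q = ∂s_{p/q}` is a coboundary of `Γ` (print: Shapiro's lemma; here
the explicit splitting of (2.4)). [cite: LanglandsShelstad1987, Lemma 2.1.D (reissue p. 12)] -/
theorem Lemma_2_1_D_holds : Lemma_2_1_D := by
  intro Γ _ X _ _ _ _ k _ _ R O p hO hR hp
  classical
  obtain ⟨⟨l₀, rfl⟩, hne⟩ := hO
  -- the orbit gauge
  let q : X → ℤˣ := fun m => if m ∈ MulAction.orbit Γ l₀ then 1 else -1
  have hmemR : ∀ m : X, m ∈ R ↔ m ∈ MulAction.orbit Γ l₀ ∨ -m ∈ MulAction.orbit Γ l₀ := by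
    intro m
    rw [← Finset.mem_coe, hR, Set.mem_union, Set.mem_neg]
  -- `𝒪 ∩ −𝒪 = ∅` (asymmetric orbit: if some `m, −m ∈ 𝒪` then `−𝒪 = 𝒪`)
  have hdisj : ∀ m : X, m ∈ MulAction.orbit Γ l₀ → -m ∉ MulAction.orbit Γ l₀ := by
    intro m hm hneg
    apply hne
    have key : ∀ x : X, x ∈ MulAction.orbit Γ l₀ → -x ∈ MulAction.orbit Γ l₀ := by
      intro x hx
      obtain ⟨g, rfl⟩ := MulAction.mem_orbit_iff.1 hx
      obtain ⟨g₀, rfl⟩ := MulAction.mem_orbit_iff.1 hm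
      -- `-(g • l₀) = (g g₀⁻¹) • (-(g₀ • l₀))`
      have : -(g • l₀) = (g * g₀⁻¹) • (-(g₀ • l₀)) := by
        rw [smul_neg, mul_smul, inv_smul_smul]
      rw [this]
      exact MulAction.mem_orbit_of_mem_orbit _ hneg
    ext x
    constructor
    · intro hx
      rw [Set.mem_neg] at hx
      simpa using key (-x) hx
    · intro hx
      rw [Set.mem_neg]
      exact key x hx
  have hst : IsStable Γ X R := by
    intro g m hm
    rw [hmemR] at hm ⊢
    rcases hm with hm | hm
    · exact Or.inl (MulAction.mem_orbit_of_mem_orbit g hm)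
    · right
      rw [← smul_neg]
      exact MulAction.mem_orbit_of_mem_orbit g hm
  have hsy : IsSymm R := by
    intro m hm
    rw [hmemR] at hm ⊢
    rw [neg_neg]
    exact hm.symm
  have hq : IsGauge R q := by
    intro m hm
    rw [hmemR] at hm
    rcases hm with hm | hm
    · simp [q, hm, hdisj m hm]
    · have : m ∉ MulAction.orbit Γ l₀ := by simpa using hdisj (-m) hm
      simp [q, hm, this]
  -- `q` is `Γ`-invariant, so `t_q = 0`
  have hmem_iff : ∀ (g : Γ) (m : X), g • m ∈ MulAction.orbit Γ l₀ ↔ m ∈ MulAction.orbit Γ l₀ := by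
    intro g m
    rw [← MulAction.orbit_eq_iff, ← MulAction.orbit_eq_iff, MulAction.orbit_smul]
  have hqinv : ∀ (g : Γ) (m : X), q (g • m) = q m := by
    intro g m
    simp only [q, hmem_iff]
  have htq : ∀ g h : Γ, tCochain Γ k R q (g, h) = 0 := by
    intro g h
    unfold tCochain
    refine Finset.sum_eq_zero fun m hm => ?_
    simp only [Finset.mem_filter, hqinv] at hm
    exact absurd (hm.2.1.symm.trans hm.2.2.1) (by decide)
  refine ⟨splitCochain k R p q, fun g h => ?_⟩
  have := cobd_splitCochain k R p q hst hsy hp hq g h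
  rw [htq, sub_zero] at this
  exact this

/-- **Lemma 2.3.B (b) holds** (printed reading, corrected in place at ED. 5/7).  Proof as printed (p. 17): using `p(σ⁻¹α) = p(α)` for the Galois
part, `μ[t_p(μ⁻¹ω, σ(μ))]` and `μ[t_p(μ⁻¹, ω)]` are re-indexed by `α ↦ μα`; all terms are then sums of `(−1)^{α^∨}` over
`R` selected by the sign pattern `(p(α), p(μ⁻¹α), p(s⁻¹α), p(μ⁻¹s⁻¹α))` (`s = ωγ`), and «performing the obvious
cancellations» pairwise under `α ↔ −α` (`(−1)^{−α^∨} = (−1)^{α^∨}`) leaves exactly the two printed index sets.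
[cite: LanglandsShelstad1987, Lemma 2.3.B (reissue pp. 16–17)] -/
theorem Lemma_2_3_B_b_holds : Lemma_2_3_B_b := by
  intro S _ X _ _ _ _ K _ _ _ Ω Γ R p μ ω γ hst hsy hga _ _ hγ hinv
  have hs2 : ∀ m : X, unitPow (-1 : Kˣ) m + unitPow (-1 : Kˣ) m = 0 := by
    intro m
    simp only [unitPow, ← TensorProduct.tmul_add, ← ofMul_mul]
    simp
  have hsneg : ∀ m : X, unitPow (-1 : Kˣ) (-m) = unitPow (-1 : Kˣ) m := by
    intro m
    rw [← sub_eq_zero, unitPow, unitPow, TensorProduct.neg_tmul, sub_eq_add_neg, ← neg_add, neg_eq_zero]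
    exact hs2 m
  have hact : ∀ l : X, μ • unitPow (-1 : Kˣ) l = unitPow (-1 : Kˣ) (μ • l) := by
    intro l
    simp [unitPow, TensorProduct.smul_tmul']
  -- Galois invariance of `p` in the two forms used
  have hγ1 : ∀ m ∈ R, p (ω⁻¹ • m) = p ((ω * γ)⁻¹ • m) := by
    intro m hm
    rw [mul_inv_rev, mul_smul]
    exact (hinv γ⁻¹ (inv_mem hγ) _ (hst ω⁻¹ m hm)).symm
  have hγ2 : ∀ m ∈ R, p (γ • μ⁻¹ • γ⁻¹ • ω⁻¹ • m) = p (μ⁻¹ • (ω * γ)⁻¹ • m) := by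
    intro m hm
    rw [mul_inv_rev, mul_smul]
    exact hinv γ hγ _ (hst μ⁻¹ _ (hst γ⁻¹ _ (hst ω⁻¹ m hm)))
  -- re-index the two `μ`-twisted terms
  have h2 : μ • tCochain S K R p (μ⁻¹ * ω, γ * μ * γ⁻¹) =
      ∑ m ∈ R with (p (μ⁻¹ • m) = 1 ∧ p ((ω * γ)⁻¹ • m) = -1 ∧ p (μ⁻¹ • (ω * γ)⁻¹ • m) = 1),
        unitPow (-1 : Kˣ) m := by
    unfold tCochain
    rw [Finset.smul_sum]
    simp only [hact]
    have step : ∑ x ∈ R with (p x = 1 ∧ p ((μ⁻¹ * ω)⁻¹ • x) = -1 ∧ p ((γ * μ * γ⁻¹)⁻¹ • (μ⁻¹ * ω)⁻¹ • x) = 1),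
        unitPow (-1 : Kˣ) (μ • x) =
        ∑ m ∈ R with (p (μ⁻¹ • m) = 1 ∧ p (ω⁻¹ • m) = -1 ∧ p (γ • μ⁻¹ • γ⁻¹ • ω⁻¹ • m) = 1),
          unitPow (-1 : Kˣ) m := by
      apply Finset.sum_nbij' (fun l => μ • l) (fun m => μ⁻¹ • m)
      · intro l hl
        simp only [Finset.mem_filter, mul_inv_rev, inv_inv, mul_smul] at hl ⊢
        refine ⟨hst μ l hl.1, ?_, ?_, ?_⟩
        · simpa [inv_smul_smul] using hl.2.1
        · simpa [inv_smul_smul] using hl.2.2.1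
        · simpa [inv_smul_smul] using hl.2.2.2
      · intro m hm
        simp only [Finset.mem_filter, mul_inv_rev, inv_inv, mul_smul] at hm ⊢
        exact ⟨hst μ⁻¹ m hm.1, hm.2.1, by simpa [smul_inv_smul] using hm.2.2.1,
          by simpa [smul_inv_smul] using hm.2.2.2⟩
      · intro l hl
        simp
      · intro m hm
        simp
      · intro l hl
        simp
    rw [step]
    apply Finset.sum_congr _ (fun _ _ => rfl)
    ext m
    simp only [Finset.mem_filter]
    constructor
    · rintro ⟨hm, h1, h2, h3⟩
      exact ⟨hm, h1, (hγ1 m hm) ▸ h2, (hγ2 m hm) ▸ h3⟩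
    · rintro ⟨hm, h1, h2, h3⟩
      exact ⟨hm, h1, (hγ1 m hm).symm ▸ h2, (hγ2 m hm).symm ▸ h3⟩
  have h3 : μ • tCochain S K R p (μ⁻¹, ω) =
      ∑ m ∈ R with (p (μ⁻¹ • m) = 1 ∧ p m = -1 ∧ p ((ω * γ)⁻¹ • m) = 1), unitPow (-1 : Kˣ) m := by
    unfold tCochain
    rw [Finset.smul_sum]
    simp only [hact]
    have step : ∑ x ∈ R with (p x = 1 ∧ p (μ⁻¹⁻¹ • x) = -1 ∧ p (ω⁻¹ • μ⁻¹⁻¹ • x) = 1),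
        unitPow (-1 : Kˣ) (μ • x) =
        ∑ m ∈ R with (p (μ⁻¹ • m) = 1 ∧ p m = -1 ∧ p (ω⁻¹ • m) = 1), unitPow (-1 : Kˣ) m := by
      apply Finset.sum_nbij' (fun l => μ • l) (fun m => μ⁻¹ • m)
      · intro l hl
        simp only [Finset.mem_filter, inv_inv] at hl ⊢
        exact ⟨hst μ l hl.1, by simpa [inv_smul_smul] using hl.2.1, hl.2.2.1, hl.2.2.2⟩
      · intro m hm
        simp only [Finset.mem_filter, inv_inv] at hm ⊢
        exact ⟨hst μ⁻¹ m hm.1, hm.2.1, by simpa [smul_inv_smul] using hm.2.2.1,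
          by simpa [smul_inv_smul] using hm.2.2.2⟩
      · intro l hl
        simp
      · intro m hm
        simp
      · intro l hl
        simp
    rw [step]
    apply Finset.sum_congr _ (fun _ _ => rfl)
    ext m
    simp only [Finset.mem_filter]
    constructor
    · rintro ⟨hm, h1, h2, h3⟩
      exact ⟨hm, h1, h2, (hγ1 m hm) ▸ h3⟩
    · rintro ⟨hm, h1, h2, h3⟩
      exact ⟨hm, h1, h2, (hγ1 m hm).symm ▸ h3⟩
  have h1 : tCochain S K R p (μ, μ⁻¹) =
      ∑ m ∈ R with (p m = 1 ∧ p (μ⁻¹ • m) = -1), unitPow (-1 : Kˣ) m := by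
    unfold tCochain
    apply Finset.sum_congr _ (fun _ _ => rfl)
    ext m
    simp only [Finset.mem_filter, inv_inv, smul_inv_smul]
    constructor
    · rintro ⟨hm, h1, h2, _⟩
      exact ⟨hm, h1, h2⟩
    · rintro ⟨hm, h1, h2⟩
      exact ⟨hm, h1, h2, h1⟩
  rw [smul_add, h1, h2, h3]
  set s : S := ω * γ with hs_def
  simp only [Finset.sum_filter]
  rw [← Finset.sum_add_distrib, ← Finset.sum_add_distrib, ← Finset.sum_add_distrib, ← sub_eq_zero,
    ← Finset.sum_sub_distrib]
  have c1 : (-1 : ℤˣ) ≠ 1 := by decide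
  have c2 : (1 : ℤˣ) ≠ -1 := by decide
  refine Finset.sum_involution (fun m _ => -m) ?_ ?_ ?_ ?_
  · intro m hm
    have hg : μ⁻¹ • m ∈ R := hst μ⁻¹ m hm
    have hsm : s⁻¹ • m ∈ R := hst _ m hm
    have hmsm : μ⁻¹ • s⁻¹ • m ∈ R := hst μ⁻¹ _ hsm
    have e1 : p (-m) = -p m := hga m hm
    have e2 : p (μ⁻¹ • -m) = -p (μ⁻¹ • m) := by rw [smul_neg]; exact hga _ hg
    have e3 : p (s⁻¹ • -m) = -p (s⁻¹ • m) := by rw [smul_neg]; exact hga _ hsm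
    have e4 : p (μ⁻¹ • s⁻¹ • -m) = -p (μ⁻¹ • s⁻¹ • m) := by
      rw [smul_neg, smul_neg]; exact hga _ hmsm
    rw [e1, e2, e3, e4, hsneg m]
    rcases Int.units_eq_one_or (p m) with k1 | k1 <;>
    rcases Int.units_eq_one_or (p (μ⁻¹ • m)) with k2 | k2 <;>
    rcases Int.units_eq_one_or (p (s⁻¹ • m)) with k3 | k3 <;>
    rcases Int.units_eq_one_or (p (μ⁻¹ • s⁻¹ • m)) with k4 | k4 <;>
      simp only [k1, k2, k3, k4, c1, c2, neg_neg, and_true, and_self, and_false, if_true, if_false, add_zero,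
        zero_add, sub_zero, sub_self, hs2]
  · intro m hm _ hmm
    have := hga m hm
    rw [hmm] at this
    exact units_ne_neg_self (p m) this
  · intro m hm
    exact hsy m hm
  · intro m hm
    simp

/-- **Lemma 2.3.B (a) holds.**  Proof as printed (pp. 16–17): `μ(x(σ′))` is `∏ a_{μα}^{μα}` over
`p(α) = 1, p(μ⁻¹σ⁻¹μα) = −1`, i.e. (re-indexing `α ↦ μα`) the sum of `a_α^α` over `p(μ⁻¹α) = 1, p(μ⁻¹σ⁻¹α) = −1`;
`σ(δ)` is re-indexed likewise using `σ(a_α) = a_{σα}` (a-data (i)); every term is then a sum over `R` selected by the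
sign pattern `(p(α), p(μ⁻¹α), p(σ⁻¹α), p(μ⁻¹σ⁻¹α))`, and the terms pair off under `α ↔ −α` using a-data (ii),
`a_{−α}^{−α} = (−1)^{α} (a_α^α)⁻¹` — the residue of the pairing is exactly the two sign products `∏ (−1)^{α^∨}`.
[cite: LanglandsShelstad1987, Lemma 2.3.B (reissue pp. 16–17)] -/
theorem Lemma_2_3_B_a_holds : Lemma_2_3_B_a := by
  intro S _ X _ _ _ _ K _ _ _ _ Ω ΓT R p a μ s hst hsy hga _ _ hs ha
  have hs2 : ∀ m : X, unitPow (-1 : Kˣ) m + unitPow (-1 : Kˣ) m = 0 := by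
    intro m
    simp only [unitPow, ← TensorProduct.tmul_add, ← ofMul_mul]
    simp
  have hs2n : ∀ m : X, -unitPow (-1 : Kˣ) m + -unitPow (-1 : Kˣ) m = 0 := by
    intro m
    rw [← neg_add, hs2, neg_zero]
  have hs2a : ∀ (m : X) (t : UnitsTensor X K), t + unitPow (-1 : Kˣ) m + unitPow (-1 : Kˣ) m = t := by
    intro m t
    rw [add_assoc, hs2, add_zero]
  have hsneg : ∀ m : X, unitPow (-1 : Kˣ) (-m) = -unitPow (-1 : Kˣ) m := by
    intro m
    simp only [unitPow, TensorProduct.neg_tmul]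
  have hnegA : ∀ l ∈ R, unitPow (a (-l)) (-l) = -unitPow (-1 : Kˣ) l - unitPow (a l) l := by
    intro l hl
    have hu : a (-l) = -1 * a l := by
      ext
      simp [ha.2 l hl]
    simp only [unitPow, hu, ofMul_mul, TensorProduct.tmul_add, TensorProduct.neg_tmul]
    abel
  -- `σ_T(a_λ^λ) = a_{σ_T λ}^{σ_T λ}` on `R`
  have hact : ∀ l ∈ R, actDiag S X K s (unitPow (a l) l) = unitPow (a (s • l)) (s • l) := by
    intro l hl
    have ha1 : (a (s • l) : K) = s • (a l : K) := by
      simpa [Subgroup.mk_smul] using ha.1 ⟨s, hs⟩ l hl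
    have hu : unitsGalAct S K s (a l) = a (s • l) := by
      ext
      simp [unitsGalAct, ha1]
    simp [actDiag, unitPow, TensorProduct.map_tmul, hu]
  -- `μ` acts through `X`
  have hactμ : ∀ l : X, μ • unitPow (a (μ • l)) l = unitPow (a (μ • l)) (μ • l) := by
    intro l
    simp [unitPow, TensorProduct.smul_tmul']
  -- `μ(x(σ′))` re-indexed by `α ↦ μα`
  have h1 : μ • uCochain S K R p (fun l => a (μ • l)) (μ⁻¹ * s * μ) =
      ∑ m ∈ R with (p (μ⁻¹ • m) = 1 ∧ p (μ⁻¹ • s⁻¹ • m) = -1), unitPow (a m) m := by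
    unfold uCochain
    rw [Finset.smul_sum]
    simp only [hactμ, mul_inv_rev, inv_inv, mul_smul]
    apply Finset.sum_nbij' (fun l => μ • l) (fun m => μ⁻¹ • m)
    · intro l hl
      simp only [Finset.mem_filter] at hl ⊢
      exact ⟨hst μ l hl.1, by simpa [inv_smul_smul] using hl.2.1, hl.2.2⟩
    · intro m hm
      simp only [Finset.mem_filter] at hm ⊢
      exact ⟨hst μ⁻¹ m hm.1, hm.2.1, by simpa [smul_inv_smul] using hm.2.2⟩
    · intro l hl
      simp
    · intro m hm
      simp
    · intro l hl
      simp
  -- `σ(δ)` re-indexed by `α ↦ σα`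
  have h2 : actDiag S X K s (∑ l ∈ R with (p l = 1 ∧ p (μ⁻¹ • l) = -1), -unitPow (a l) l) =
      ∑ m ∈ R with (p (s⁻¹ • m) = 1 ∧ p (μ⁻¹ • s⁻¹ • m) = -1), -unitPow (a m) m := by
    rw [map_sum]
    have hc : ∀ l ∈ R.filter (fun l => p l = 1 ∧ p (μ⁻¹ • l) = -1),
        actDiag S X K s (-unitPow (a l) l) = -unitPow (a (s • l)) (s • l) := by
      intro l hl
      rw [map_neg, hact l (Finset.mem_filter.1 hl).1]
    rw [Finset.sum_congr rfl hc]
    apply Finset.sum_nbij' (fun l => s • l) (fun m => s⁻¹ • m)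
    · intro l hl
      simp only [Finset.mem_filter] at hl ⊢
      exact ⟨hst s l hl.1, by simpa [inv_smul_smul] using hl.2.1, by simpa [inv_smul_smul] using hl.2.2⟩
    · intro m hm
      simp only [Finset.mem_filter] at hm ⊢
      exact ⟨hst s⁻¹ m hm.1, hm.2.1, hm.2.2⟩
    · intro l hl
      simp
    · intro m hm
      simp
    · intro l hl
      simp
  rw [h1, h2]
  unfold uCochain
  simp only [Finset.sum_filter]
  rw [← Finset.sum_sub_distrib, ← Finset.sum_sub_distrib, ← Finset.sum_add_distrib, ← Finset.sum_add_distrib,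
    ← sub_eq_zero, ← Finset.sum_sub_distrib]
  have c1 : (-1 : ℤˣ) ≠ 1 := by decide
  have c2 : (1 : ℤˣ) ≠ -1 := by decide
  refine Finset.sum_involution (fun m _ => -m) ?_ ?_ ?_ ?_
  · intro m hm
    have hg : μ⁻¹ • m ∈ R := hst μ⁻¹ m hm
    have hsm : s⁻¹ • m ∈ R := hst _ m hm
    have hmsm : μ⁻¹ • s⁻¹ • m ∈ R := hst μ⁻¹ _ hsm
    have e1 : p (-m) = -p m := hga m hm
    have e2 : p (μ⁻¹ • -m) = -p (μ⁻¹ • m) := by rw [smul_neg]; exact hga _ hg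
    have e3 : p (s⁻¹ • -m) = -p (s⁻¹ • m) := by rw [smul_neg]; exact hga _ hsm
    have e4 : p (μ⁻¹ • s⁻¹ • -m) = -p (μ⁻¹ • s⁻¹ • m) := by
      rw [smul_neg, smul_neg]; exact hga _ hmsm
    rw [e1, e2, e3, e4, hnegA m hm, hsneg m]
    rcases Int.units_eq_one_or (p m) with k1 | k1 <;>
    rcases Int.units_eq_one_or (p (μ⁻¹ • m)) with k2 | k2 <;>
    rcases Int.units_eq_one_or (p (s⁻¹ • m)) with k3 | k3 <;>
    rcases Int.units_eq_one_or (p (μ⁻¹ • s⁻¹ • m)) with k4 | k4 <;>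
      (simp [k1, k2, k3, k4, c1, c2]; (try simp only [hs2n, hs2a, neg_add_cancel]); try abel)
  · intro m hm _ h
    have := hga m hm
    rw [h] at this
    exact units_ne_neg_self (p m) this
  · intro m hm
    exact hsy m hm
  · intro m hm
    simp

/-- **Lemma 2.3.A holds** (cochain form `Lemma_2_3_A`, printed reading).  Proof as printed (p. 16: «That `b(σ)` is trivial
follows from: Lemma 2.3.B»): by (a) and (b) the cochain is `δσ_T(δ)⁻¹` times the SQUARE of the two sign products,
and `((−1)^{α^∨})² = 1`; hence it is the coboundary of `y = δ⁻¹` (additively `y = −δ`).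
[cite: LanglandsShelstad1987, Lemma 2.3.A (reissue pp. 15–17)] -/
theorem Lemma_2_3_A_holds : Lemma_2_3_A := by
  intro S _ X _ _ _ _ K _ _ _ _ Ω Γ ΓT R p a μ ωT γT hst hsy hga hΩ hμ hinv ha hdec
  refine ⟨-(∑ l ∈ R with (p l = 1 ∧ p (μ⁻¹ • l) = -1), -unitPow (a l) l), ?_⟩
  intro s hs
  obtain ⟨hω, hγ, hsd⟩ := hdec s hs
  have hA := Lemma_2_3_B_a_holds S X K Ω ΓT R p a μ s hst hsy hga hΩ hμ hs ha
  have hB := Lemma_2_3_B_b_holds S X K Ω Γ R p μ (ωT s) (γT s) hst hsy hga hμ hω hγ hinv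
  rw [← hsd] at hB
  rw [hA, hB, map_neg, sub_neg_eq_add]
  have hs2 : ∀ m : X, unitPow (-1 : Kˣ) m + unitPow (-1 : Kˣ) m = 0 := by
    intro m
    simp only [unitPow, ← TensorProduct.tmul_add, ← ofMul_mul]
    simp
  have hP : ∀ T : Finset X, (∑ l ∈ T, unitPow (-1 : Kˣ) l) + (∑ l ∈ T, unitPow (-1 : Kˣ) l) = 0 := by
    intro T
    rw [← Finset.sum_add_distrib]
    exact Finset.sum_eq_zero (fun m _ => hs2 m)
  have key : ∀ (d A P Q : UnitsTensor X K), P + P = 0 → Q + Q = 0 → d - A + P + Q + (P + Q) = -A + d := by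
    intro d A P Q hP hQ
    have h4 : (P + Q) + (P + Q) = 0 := by rw [add_add_add_comm, hP, hQ, add_zero]
    calc d - A + P + Q + (P + Q) = (d - A) + ((P + Q) + (P + Q)) := by abel
      _ = -A + d := by rw [h4, add_zero]; abel
  exact key _ _ _ _ (hP _) (hP _)

/-- **Lemma 2.2.C (a) holds**: `v_p − v_q = ∂x` with the explicit `x = ∑_{p(λ) = −1, q(λ) = 1} b_λ^λ`.  Print (p. 13)
reduces by Shapiro's lemma to `R = {±λ}`, `q = −p`, where its witness is `x = b_λ^{−λ}`; the displayed `x` is that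
witness summed over `R` (for `q = −p` it is `∑_{p(λ)=−1} b_λ^λ`), and the verification is the same bookkeeping as in
Lemma 2.2.B: re-index `σ(x)` by `λ ↦ σλ` (`σ(b_λ^λ) = b_{σλ}^{σλ}`), collect over `R` by the sign pattern
`(p(λ), q(λ), p(σ⁻¹λ), q(σ⁻¹λ))`, and pair `λ ↔ −λ` using `b_{−λ}^{−λ} = (b_λ^λ)⁻¹`.
[cite: LanglandsShelstad1987, Lemma 2.2.C (a) (reissue p. 13)] -/
theorem Lemma_2_2_C_a_holds : Lemma_2_2_C_a := by
  intro Γ _ X _ _ _ _ K _ _ _ _ R p q b hst hsy hga hqa hb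
  refine ⟨∑ l ∈ R with (p l = -1 ∧ q l = 1), unitPow (b l) l, fun σ => ?_⟩
  have hneg : ∀ l ∈ R, unitPow (b (-l)) (-l) = -(unitPow (b l) l : UnitsTensor X K) := by
    intro l hl
    simp only [unitPow, hb.2 l hl, TensorProduct.neg_tmul]
  have hact : ∀ l ∈ R, actDiag Γ X K σ (unitPow (b l) l) = unitPow (b (σ • l)) (σ • l) := by
    intro l hl
    have hu : unitsGalAct Γ K σ (b l) = b (σ • l) := by
      ext
      simp [unitsGalAct, hb.1 σ l hl]
    simp [actDiag, unitPow, TensorProduct.map_tmul, hu]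
  have h1 : actDiag Γ X K σ (∑ l ∈ R with (p l = -1 ∧ q l = 1), unitPow (b l) l) =
      ∑ m ∈ R with (p (σ⁻¹ • m) = -1 ∧ q (σ⁻¹ • m) = 1), unitPow (b m) m := by
    rw [map_sum]
    have hc : ∀ l ∈ R.filter (fun l => p l = -1 ∧ q l = 1),
        actDiag Γ X K σ (unitPow (b l) l) = unitPow (b (σ • l)) (σ • l) :=
      fun l hl => hact l (Finset.mem_filter.1 hl).1
    rw [Finset.sum_congr rfl hc]
    apply Finset.sum_nbij' (fun l => σ • l) (fun m => σ⁻¹ • m)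
    · intro l hl
      simp only [Finset.mem_filter] at hl ⊢
      exact ⟨hst σ l hl.1, by simpa [inv_smul_smul] using hl.2.1, by simpa [inv_smul_smul] using hl.2.2⟩
    · intro m hm
      simp only [Finset.mem_filter] at hm ⊢
      exact ⟨hst σ⁻¹ m hm.1, hm.2.1, hm.2.2⟩
    · intro l hl
      simp
    · intro m hm
      simp
    · intro l hl
      simp
  rw [h1]
  unfold vCochain
  simp only [Finset.sum_filter]
  rw [← Finset.sum_sub_distrib, ← Finset.sum_sub_distrib, ← sub_eq_zero, ← Finset.sum_sub_distrib]
  have c1 : (-1 : ℤˣ) ≠ 1 := by decide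
  have c2 : (1 : ℤˣ) ≠ -1 := by decide
  refine Finset.sum_involution (fun m _ => -m) ?_ ?_ ?_ ?_
  · intro m hm
    have hs : σ⁻¹ • m ∈ R := hst σ⁻¹ m hm
    have e1 : p (-m) = -p m := hga m hm
    have e2 : q (-m) = -q m := hqa m hm
    have e3 : p (σ⁻¹ • -m) = -p (σ⁻¹ • m) := by rw [smul_neg]; exact hga _ hs
    have e4 : q (σ⁻¹ • -m) = -q (σ⁻¹ • m) := by rw [smul_neg]; exact hqa _ hs
    rw [e1, e2, e3, e4, hneg m hm]
    rcases Int.units_eq_one_or (p m) with k1 | k1 <;>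
    rcases Int.units_eq_one_or (q m) with k2 | k2 <;>
    rcases Int.units_eq_one_or (p (σ⁻¹ • m)) with k3 | k3 <;>
    rcases Int.units_eq_one_or (q (σ⁻¹ • m)) with k4 | k4 <;>
      simp [k1, k2, k3, k4, c1, c2]
  · intro m hm _ h
    have := hga m hm
    rw [h] at this
    exact units_ne_neg_self (p m) this
  · intro m hm
    exact hsy m hm
  · intro m hm
    simp

/-- **Lemma 2.2.C (b) holds**: for `R = ±O` with `O` an asymmetric `Γ`-orbit, `v_p = ∂x` with the explicit
`x = ∑_{λ ∈ O, p(λ) = −1} b_λ^λ`.  Print (p. 13): «Again assume `R = {±λ}`. Then `v_p = 1`» (after Shapiro); summed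
over the orbit this is the displayed witness, and the verification re-indexes `σ(x)` by `λ ↦ σλ` (`O` is `Γ`-stable),
collects over `R` by the pattern `(p(λ), p(σ⁻¹λ), [λ ∈ O])` and pairs `λ ↔ −λ` (exactly one of `±λ` lies in `O`,
`b_{−λ}^{−λ} = (b_λ^λ)⁻¹`). [cite: LanglandsShelstad1987, Lemma 2.2.C (b) (reissue p. 13)] -/
theorem Lemma_2_2_C_b_holds : Lemma_2_2_C_b := by
  intro Γ _ X _ _ _ _ K _ _ _ _ R O p b hO hRO hga hb
  classical
  obtain ⟨⟨l₀, hOl⟩, hOne⟩ := hO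
  have hmemR : ∀ m : X, m ∈ R ↔ m ∈ O ∨ -m ∈ O := by
    intro m
    rw [← Finset.mem_coe, hRO, Set.mem_union, Set.mem_neg]
  have hOst : ∀ (τ : Γ) (m : X), m ∈ O → τ • m ∈ O := by
    intro τ m hm
    rw [hOl, MulAction.mem_orbit_iff] at hm ⊢
    obtain ⟨ρ, rfl⟩ := hm
    exact ⟨τ * ρ, mul_smul τ ρ l₀⟩
  have hOneg : ∀ m ∈ O, -m ∉ O := by
    intro m hm hnm
    apply hOne
    have h1 : MulAction.orbit Γ m = O := by
      rw [hOl] at hm ⊢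
      exact MulAction.orbit_eq_iff.2 hm
    have h2 : MulAction.orbit Γ (-m) = O := by
      rw [hOl] at hnm ⊢
      exact MulAction.orbit_eq_iff.2 hnm
    ext x
    rw [Set.mem_neg]
    constructor
    · intro hx
      rw [← h1, MulAction.mem_orbit_iff] at hx
      obtain ⟨τ, hτ⟩ := hx
      rw [← h2, MulAction.mem_orbit_iff]
      exact ⟨τ, by rw [smul_neg, hτ, neg_neg]⟩
    · intro hx
      rw [← h2, MulAction.mem_orbit_iff] at hx
      obtain ⟨τ, hτ⟩ := hx
      rw [← h1, MulAction.mem_orbit_iff]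
      exact ⟨τ, by rw [← neg_neg (τ • m), ← smul_neg, hτ]⟩
  have hst : ∀ (τ : Γ), ∀ m ∈ R, τ • m ∈ R := by
    intro τ m hm
    rw [hmemR] at hm ⊢
    rcases hm with h | h
    · exact Or.inl (hOst τ m h)
    · right
      rw [← smul_neg]
      exact hOst τ (-m) h
  have hsy : ∀ m ∈ R, -m ∈ R := by
    intro m hm
    rw [hmemR] at hm ⊢
    rw [neg_neg]
    exact hm.symm
  refine ⟨∑ l ∈ R with (l ∈ O ∧ p l = -1), unitPow (b l) l, fun σ => ?_⟩
  have hneg : ∀ l ∈ R, unitPow (b (-l)) (-l) = -(unitPow (b l) l : UnitsTensor X K) := by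
    intro l hl
    simp only [unitPow, hb.2 l hl, TensorProduct.neg_tmul]
  have hact : ∀ l ∈ R, actDiag Γ X K σ (unitPow (b l) l) = unitPow (b (σ • l)) (σ • l) := by
    intro l hl
    have hu : unitsGalAct Γ K σ (b l) = b (σ • l) := by
      ext
      simp [unitsGalAct, hb.1 σ l hl]
    simp [actDiag, unitPow, TensorProduct.map_tmul, hu]
  have h1 : actDiag Γ X K σ (∑ l ∈ R with (l ∈ O ∧ p l = -1), unitPow (b l) l) =
      ∑ m ∈ R with (m ∈ O ∧ p (σ⁻¹ • m) = -1), unitPow (b m) m := by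
    rw [map_sum]
    have hc : ∀ l ∈ R.filter (fun l => l ∈ O ∧ p l = -1),
        actDiag Γ X K σ (unitPow (b l) l) = unitPow (b (σ • l)) (σ • l) :=
      fun l hl => hact l (Finset.mem_filter.1 hl).1
    rw [Finset.sum_congr rfl hc]
    apply Finset.sum_nbij' (fun l => σ • l) (fun m => σ⁻¹ • m)
    · intro l hl
      simp only [Finset.mem_filter] at hl ⊢
      exact ⟨hst σ l hl.1, hOst σ l hl.2.1, by simpa [inv_smul_smul] using hl.2.2⟩
    · intro m hm
      simp only [Finset.mem_filter] at hm ⊢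
      exact ⟨hst σ⁻¹ m hm.1, hOst σ⁻¹ m hm.2.1, hm.2.2⟩
    · intro l hl
      simp
    · intro m hm
      simp
    · intro l hl
      simp
  rw [h1]
  unfold vCochain
  simp only [Finset.sum_filter]
  rw [← Finset.sum_sub_distrib, ← sub_eq_zero, ← Finset.sum_sub_distrib]
  have c1 : (-1 : ℤˣ) ≠ 1 := by decide
  have c2 : (1 : ℤˣ) ≠ -1 := by decide
  refine Finset.sum_involution (fun m _ => -m) ?_ ?_ ?_ ?_
  · intro m hm
    have hs : σ⁻¹ • m ∈ R := hst σ⁻¹ m hm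
    have e1 : p (-m) = -p m := hga m hm
    have e3 : p (σ⁻¹ • -m) = -p (σ⁻¹ • m) := by rw [smul_neg]; exact hga _ hs
    rw [e1, e3, hneg m hm]
    rcases (hmemR m).1 hm with ho | ho
    · have hno : -m ∉ O := hOneg m ho
      rcases Int.units_eq_one_or (p m) with k1 | k1 <;>
      rcases Int.units_eq_one_or (p (σ⁻¹ • m)) with k3 | k3 <;>
        simp [k1, k3, ho, hno, c1, c2]
    · have hno : m ∉ O := fun h => hOneg m h ho
      rcases Int.units_eq_one_or (p m) with k1 | k1 <;>
      rcases Int.units_eq_one_or (p (σ⁻¹ • m)) with k3 | k3 <;>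
        simp [k1, k3, ho, hno, c1, c2]
  · intro m hm _ h
    have := hga m hm
    rw [h] at this
    exact units_ne_neg_self (p m) this
  · intro m hm
    exact hsy m hm
  · intro m hm
    simp

end Literature.NumberTheory.Automorphic.LanglandsShelstad1987.KeyLemmasI

end
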